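import Mathlib

/-!
# Crux `HyperoctahedralRP.HRP2Rigidity` (stmt-CriticalPhenomena-1979) — negative-side support: tightness of S3

Line `xray-mellin-transfer` (lead's skeleton `Cruxes/HRP2Rigidity/Lines/xray-mellin-transfer.lean`), stub
`stub_periodicTypeLiouville` (S3): an entire `T`-periodic `G` with `‖G ω‖ ≤ C e^{β |Im ω|}` and `β T < 2π` is
constant.  Refuter (drefute gen-2) TIGHTNESS LEMMAS: the strict inequality cannot be weakened to `β T ≤ 2π` —
`G ω = exp (2π i ω)` is entire, `1`-periodic, of exponential type exactly `2π`, and not constant — and the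
hypothesis `0 < T` cannot be weakened to `0 ≤ T` (same witness at `T = 0`).  Consequently the window `β < 4` of
the planar four-line rigidity lemma (S4, period `T = π/2`) is the exact reach of the strip-tiling +
periodic-Liouville METHOD (Boas, *Entire Functions*, Thm 6.10.1: a `2π`-periodic entire function of exponential
type `τ` is a trigonometric polynomial of degree `≤ τ`), not a slack in the bookkeeping.  Theorem-only file.
-/

noncomputable section

namespace Summit.CriticalPhenomena.Ising3DConformalLimit.Theorems.HRP2Rigidity.Negative

open Complex

/-- `ω ↦ exp (2π i ω)` is entire. [folklore] -/
theorem differentiable_exp_two_pi_I_mul :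
    Differentiable ℂ fun ω : ℂ => exp (2 * Real.pi * I * ω) := by
  fun_prop

/-- `ω ↦ exp (2π i ω)` has period `1` (`exp (2π i) = 1`). [folklore] -/
theorem exp_two_pi_I_mul_add_one (ω : ℂ) :
    exp (2 * Real.pi * I * (ω + (1 : ℝ))) = exp (2 * Real.pi * I * ω) := by
  rw [Complex.ofReal_one, mul_add, mul_one, Complex.exp_add, Complex.exp_two_pi_mul_I, mul_one]

/-- `‖exp (2π i ω)‖ = e^{-2π Im ω}`. [folklore] -/
theorem norm_exp_two_pi_I_mul (ω : ℂ) :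
    ‖exp (2 * Real.pi * I * ω)‖ = Real.exp (-(2 * Real.pi * ω.im)) := by
  rw [Complex.norm_exp]
  congr 1
  simp [Complex.mul_re, Complex.mul_im]

/-- Exponential type `2π`: `‖exp (2π i ω)‖ ≤ 1 · e^{2π |Im ω|}`. [folklore] -/
theorem norm_exp_two_pi_I_mul_le (ω : ℂ) :
    ‖exp (2 * Real.pi * I * ω)‖ ≤ 1 * Real.exp (2 * Real.pi * |ω.im|) := by
  rw [norm_exp_two_pi_I_mul, one_mul]
  apply Real.exp_le_exp.2
  have h1 : -ω.im ≤ |ω.im| := neg_le_abs ω.im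
  have h2 : 0 < 2 * Real.pi := by positivity
  nlinarith

/-- `exp (2π i · (1/2)) = exp (π i) = -1`. [folklore] -/
theorem exp_two_pi_I_mul_half : exp (2 * Real.pi * I * (1 / 2)) = -1 := by
  rw [show 2 * (Real.pi : ℂ) * I * (1 / 2) = Real.pi * I by ring, Complex.exp_pi_mul_I]

/-- **Tightness of S3 (`stub_periodicTypeLiouville`).** The registered statement with its strict window
`β * T < 2 * π` weakened to `≤` (everything else verbatim) is false: `T = 1`, `β = 2π`, `C = 1`,
`G = exp (2π i ·)` satisfies every hypothesis and `G 0 = 1 ≠ -1 = G (1/2)`.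
[folklore; Boas, Entire Functions, Thm 6.10.1 (sharpness of the degree bound)] -/
theorem periodicTypeLiouville_sharp :
    ¬ (∀ (G : ℂ → ℂ) (T β C : ℝ), 0 < T → 0 ≤ β → β * T ≤ 2 * Real.pi → Differentiable ℂ G →
      (∀ ω : ℂ, G (ω + T) = G ω) → (∀ ω : ℂ, ‖G ω‖ ≤ C * Real.exp (β * |ω.im|)) →
      ∀ z w : ℂ, G z = G w) := by
  intro h
  have hβ : (0 : ℝ) ≤ 2 * Real.pi := by positivity
  have hβT : 2 * Real.pi * 1 ≤ 2 * Real.pi := by rw [mul_one]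
  have key := h (fun ω : ℂ => exp (2 * Real.pi * I * ω)) 1 (2 * Real.pi) 1 one_pos hβ hβT
    differentiable_exp_two_pi_I_mul exp_two_pi_I_mul_add_one norm_exp_two_pi_I_mul_le 0 (1 / 2)
  simp only [mul_zero, Complex.exp_zero] at key
  rw [exp_two_pi_I_mul_half] at key
  norm_num at key

/-- **Load-bearing hypothesis `0 < T` of S3.** With `0 ≤ T` in place of `0 < T` (everything else verbatim)
the statement is false: at `T = 0` periodicity is vacuous and `β T = 0 < 2π` for every `β`, so it would assert
that every entire function of finite exponential type is constant; `G = exp (2π i ·)`, `β = 2π` refutes it.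
[folklore] -/
theorem periodicTypeLiouville_false_of_period_zero :
    ¬ (∀ (G : ℂ → ℂ) (T β C : ℝ), 0 ≤ T → 0 ≤ β → β * T < 2 * Real.pi → Differentiable ℂ G →
      (∀ ω : ℂ, G (ω + T) = G ω) → (∀ ω : ℂ, ‖G ω‖ ≤ C * Real.exp (β * |ω.im|)) →
      ∀ z w : ℂ, G z = G w) := by
  intro h
  have hβ : (0 : ℝ) ≤ 2 * Real.pi := by positivity
  have hβT : 2 * Real.pi * 0 < 2 * Real.pi := by rw [mul_zero]; positivity
  have key := h (fun ω : ℂ => exp (2 * Real.pi * I * ω)) 0 (2 * Real.pi) 1 le_rfl hβ hβT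
    differentiable_exp_two_pi_I_mul (fun ω => by rw [Complex.ofReal_zero, add_zero])
    norm_exp_two_pi_I_mul_le 0 (1 / 2)
  simp only [mul_zero, Complex.exp_zero] at key
  rw [exp_two_pi_I_mul_half] at key
  norm_num at key

/-- Sanity: the witness is of exponential type EXACTLY `2π`: the bound is attained on the lower half-plane,
`‖G (-i b)‖ = e^{2π b}`. [folklore] -/
theorem norm_exp_two_pi_I_mul_neg_I_mul (b : ℝ) :
    ‖exp (2 * Real.pi * I * (-(I * b)))‖ = Real.exp (2 * Real.pi * b) := by
  rw [norm_exp_two_pi_I_mul]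
  congr 1
  simp

end Summit.CriticalPhenomena.Ising3DConformalLimit.Theorems.HRP2Rigidity.Negative

end
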